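import Mathlib.Analysis.Calculus.Deriv.Polynomial
import Mathlib.Analysis.Calculus.Deriv.Inv
import Mathlib.Analysis.Calculus.Deriv.Pow
import Mathlib.RingTheory.Algebraic.Integral
import Mathlib.Tactic.FieldSimp
import Mathlib.Tactic.Positivity

/-!
# `StokesGeneration` (stmt-KontsevichZagierPeriods-3586) — line `fibrewise_stokes`, stub `stub_quadPoleReduction`

Registered rung stub (rung 8, W4) of the line `fibrewise_stokes` of the crux `StokesGeneration`
(route UnfoldedStokes): **the reduction certificate for a power of a real quadratic.**

Rung 8 decomposes every real-algebraic rational integrand on `[0,1]` into fibrewise Stokes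
elements via real partial fractions. A partial-fraction term `(a t + b)/q^{n+1}` with
`q = (t − u)² + v²`, `v ≠ 0`, has to be rewritten as an EXACT part (the derivative of a rational
function `S/qⁿ` with real-algebraic data), a dlog part `e₁ · q′/q` (`q′ = 2(t − u)`) and an
angular part `e₂ · v/q` (`v/q = Im (1/(t − (u + iv)))`), with `S ∈ ℝ[X]` of algebraic
coefficients and `e₁, e₂` algebraic. This file proves exactly that, by induction on `n`:

* `n = 0`: `a t + b = (a/2) · 2(t − u) + (b + a u)`, so `S = 0`, `e₁ = a/2`, `e₂ = (b + a u)/v`.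
* `n + 1`: `(a/2) q′/q^{n+2} = (−(a/2)/((n+1) q^{n+1}))′` and the classical reduction
  `1/q^{n+2} = ((t − u)/(2(n+1) v² q^{n+1}))′ + (2n+1)/(2(n+1) v²) · 1/q^{n+1}`; the last term is
  handled by the induction hypothesis (with `a := 0`), and the new polynomial is
  `S = C α + C β · (X − C u) + S₀ · ((X − C u)² + C v²)`.

All constants stay algebraic because real algebraic numbers are closed under the field operations,
and coefficients of sums/products of polynomials with algebraic coefficients are algebraic
(`Polynomial.coeff_mul` is a finite sum).

References: folklore calculus (Hermite/Ostrogradsky reduction of `∫ dt/q^{n+1}`); M. Kontsevich,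
D. Zagier, *Periods* (2001), §1.2 for the role of the Stokes rule.
-/

noncomputable section

-- `Summit.KontsevichZagierPeriods.KontsevichZagierPeriods.…` is the tree's mandated layout (single-conjunct summit).
set_option linter.dupNamespace false

namespace Summit.KontsevichZagierPeriods.KontsevichZagierPeriods.Cruxes.StokesGeneration.FibrewiseStokes

open Polynomial

/-! ## Algebraicity bookkeeping -/

/-- Real algebraic numbers are closed under division. [folklore] -/
theorem quadPole_isAlgebraic_div {a b : ℝ} (ha : IsAlgebraic ℚ a) (hb : IsAlgebraic ℚ b) :
    IsAlgebraic ℚ (a / b) := by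
  rw [div_eq_mul_inv]
  exact ha.mul hb.inv

/-- The coefficients of a constant polynomial with algebraic value are algebraic. [folklore] -/
theorem quadPole_coeff_C {c : ℝ} (hc : IsAlgebraic ℚ c) :
    ∀ j, IsAlgebraic ℚ ((C c : ℝ[X]).coeff j) := fun j => by
  rw [coeff_C]
  split_ifs
  exacts [hc, isAlgebraic_zero]

/-- The coefficients of `X` are algebraic. [folklore] -/
theorem quadPole_coeff_X : ∀ j, IsAlgebraic ℚ ((X : ℝ[X]).coeff j) := fun j => by
  rw [coeff_X]
  split_ifs
  exacts [isAlgebraic_one, isAlgebraic_zero]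

/-- Polynomials with algebraic coefficients are closed under addition. [folklore] -/
theorem quadPole_coeff_add {p q : ℝ[X]} (hp : ∀ j, IsAlgebraic ℚ (p.coeff j))
    (hq : ∀ j, IsAlgebraic ℚ (q.coeff j)) : ∀ j, IsAlgebraic ℚ ((p + q).coeff j) := fun j => by
  rw [coeff_add]
  exact (hp j).add (hq j)

/-- Polynomials with algebraic coefficients are closed under subtraction. [folklore] -/
theorem quadPole_coeff_sub {p q : ℝ[X]} (hp : ∀ j, IsAlgebraic ℚ (p.coeff j))
    (hq : ∀ j, IsAlgebraic ℚ (q.coeff j)) : ∀ j, IsAlgebraic ℚ ((p - q).coeff j) := fun j => by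
  rw [coeff_sub]
  exact (hp j).sub (hq j)

/-- Polynomials with algebraic coefficients are closed under multiplication
(`Polynomial.coeff_mul` is a finite sum of products of coefficients). [folklore] -/
theorem quadPole_coeff_mul {p q : ℝ[X]} (hp : ∀ j, IsAlgebraic ℚ (p.coeff j))
    (hq : ∀ j, IsAlgebraic ℚ (q.coeff j)) : ∀ j, IsAlgebraic ℚ ((p * q).coeff j) := fun j => by
  rw [coeff_mul]
  exact Finset.sum_induction _ (fun x => IsAlgebraic ℚ x) (fun a b ha hb => ha.add hb)
    isAlgebraic_zero (fun x _ => (hp x.1).mul (hq x.2))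

/-- Polynomials with algebraic coefficients are closed under powers. [folklore] -/
theorem quadPole_coeff_pow {p : ℝ[X]} (hp : ∀ j, IsAlgebraic ℚ (p.coeff j)) :
    ∀ (m j : ℕ), IsAlgebraic ℚ ((p ^ m).coeff j)
  | 0, j => by
    rw [pow_zero, coeff_one]
    split_ifs
    exacts [isAlgebraic_one, isAlgebraic_zero]
  | m + 1, j => by
    rw [pow_succ]
    exact quadPole_coeff_mul (quadPole_coeff_pow hp m) hp j

/-! ## Calculus of `q = (x − u)² + v²` -/

/-- `q = (t − u)² + v² > 0` when `v ≠ 0`. [folklore] -/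
theorem quadPole_pos {v : ℝ} (hv : v ≠ 0) (u t : ℝ) : 0 < (t - u) ^ 2 + v ^ 2 := by
  positivity

/-- `q′ = 2(t − u)`. [folklore] -/
theorem quadPole_hasDerivAt_quad (u v t : ℝ) :
    HasDerivAt (fun x : ℝ => (x - u) ^ 2 + v ^ 2) (2 * (t - u)) t := by
  have h := (((hasDerivAt_id' (x := t)).sub_const u).fun_pow 2).add_const (v ^ 2)
  exact h.congr_deriv (by simp)

/-- `(q^{n+1})′ = (n+1) qⁿ q′`. [folklore] -/
theorem quadPole_hasDerivAt_pow (u v t : ℝ) (n : ℕ) :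
    HasDerivAt (fun x : ℝ => ((x - u) ^ 2 + v ^ 2) ^ (n + 1))
      (((n:ℝ) + 1) * ((t - u) ^ 2 + v ^ 2) ^ n * (2 * (t - u))) t := by
  have h := (quadPole_hasDerivAt_quad u v t).fun_pow (n + 1)
  exact h.congr_deriv (by simp)

/-- `(1/q^{n+1})′ = −(n+1) q′/q^{n+2}`. [folklore] -/
theorem quadPole_hasDerivAt_inv_pow {u v : ℝ} (hv : v ≠ 0) (n : ℕ) (t : ℝ) :
    HasDerivAt (fun x : ℝ => 1 / ((x - u) ^ 2 + v ^ 2) ^ (n + 1))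
      (-(((n:ℝ) + 1) * (2 * (t - u))) / ((t - u) ^ 2 + v ^ 2) ^ (n + 2)) t := by
  have hq : (t - u) ^ 2 + v ^ 2 ≠ 0 := (quadPole_pos hv u t).ne'
  have h := (hasDerivAt_const t (1:ℝ)).fun_div (quadPole_hasDerivAt_pow u v t n) (pow_ne_zero _ hq)
  refine h.congr_deriv ?_
  field_simp
  ring

/-- `((t − u)/q^{n+1})′ = 1/q^{n+1} − (n+1)(t − u) q′/q^{n+2}`. [folklore] -/
theorem quadPole_hasDerivAt_lin_div_pow {u v : ℝ} (hv : v ≠ 0) (n : ℕ) (t : ℝ) :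
    HasDerivAt (fun x : ℝ => (x - u) / ((x - u) ^ 2 + v ^ 2) ^ (n + 1))
      (1 / ((t - u) ^ 2 + v ^ 2) ^ (n + 1)
        - ((n:ℝ) + 1) * (t - u) * (2 * (t - u)) / ((t - u) ^ 2 + v ^ 2) ^ (n + 2)) t := by
  have hq : (t - u) ^ 2 + v ^ 2 ≠ 0 := (quadPole_pos hv u t).ne'
  have h := ((hasDerivAt_id' (x := t)).sub_const u).fun_div (quadPole_hasDerivAt_pow u v t n)
    (pow_ne_zero _ hq)
  refine h.congr_deriv ?_
  field_simp
  ring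

/-! ## The induction -/

/-- Base case `n = 0`: `a t + b = (a/2) · 2(t − u) + (b + a u)`, so `(a t + b)/q` is already a
combination of the dlog and angular parts; `S = 0`, `e₁ = a/2`, `e₂ = (b + a u)/v`. [folklore] -/
theorem quadPole_base {u v : ℝ} (hv : v ≠ 0) (hu : IsAlgebraic ℚ u) (hva : IsAlgebraic ℚ v)
    {a b : ℝ} (ha : IsAlgebraic ℚ a) (hb : IsAlgebraic ℚ b) :
    ∃ (S : Polynomial ℝ) (e₁ e₂ : ℝ), (∀ j, IsAlgebraic ℚ (S.coeff j)) ∧ IsAlgebraic ℚ e₁ ∧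
      IsAlgebraic ℚ e₂ ∧
      ∀ t : ℝ, HasDerivAt (fun x : ℝ => S.eval x / ((x - u) ^ 2 + v ^ 2) ^ 0)
        ((a * t + b) / ((t - u) ^ 2 + v ^ 2) ^ (0 + 1)
          - e₁ * (2 * (t - u)) / ((t - u) ^ 2 + v ^ 2) - e₂ * v / ((t - u) ^ 2 + v ^ 2)) t := by
  have h2 : IsAlgebraic ℚ (2:ℝ) := by simpa using isAlgebraic_nat (R := ℚ) (A := ℝ) 2
  refine ⟨0, a / 2, (b + a * u) / v, fun j => ?_, quadPole_isAlgebraic_div ha h2,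
    quadPole_isAlgebraic_div (hb.add (ha.mul hu)) hva, fun t => ?_⟩
  · rw [coeff_zero]
    exact isAlgebraic_zero
  · have hq : (t - u) ^ 2 + v ^ 2 ≠ 0 := (quadPole_pos hv u t).ne'
    have h0 : (fun x : ℝ => (0 : Polynomial ℝ).eval x / ((x - u) ^ 2 + v ^ 2) ^ 0) = fun _ => 0 := by
      funext x
      simp
    rw [h0]
    refine (hasDerivAt_const t (0:ℝ)).congr_deriv ?_
    field_simp
    ring

/-- Inductive step: from the certificate for exponent `n` (all `a, b`) to exponent `n + 1`, via
`(a/2) q′/q^{n+2} = (−(a/2)/((n+1) q^{n+1}))′` and the reduction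
`1/q^{n+2} = ((t − u)/(2(n+1) v² q^{n+1}))′ + (2n+1)/(2(n+1) v²) · 1/q^{n+1}`, the last term being
absorbed by the induction hypothesis with `a := 0`, `b := (b + a u)(2n+1)/(2(n+1) v²)`. [folklore] -/
theorem quadPole_step {u v : ℝ} (hv : v ≠ 0) (hu : IsAlgebraic ℚ u) (hva : IsAlgebraic ℚ v) (n : ℕ)
    (ih : ∀ a b : ℝ, IsAlgebraic ℚ a → IsAlgebraic ℚ b →
      ∃ (S : Polynomial ℝ) (e₁ e₂ : ℝ), (∀ j, IsAlgebraic ℚ (S.coeff j)) ∧ IsAlgebraic ℚ e₁ ∧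
        IsAlgebraic ℚ e₂ ∧
        ∀ t : ℝ, HasDerivAt (fun x : ℝ => S.eval x / ((x - u) ^ 2 + v ^ 2) ^ n)
          ((a * t + b) / ((t - u) ^ 2 + v ^ 2) ^ (n + 1)
            - e₁ * (2 * (t - u)) / ((t - u) ^ 2 + v ^ 2) - e₂ * v / ((t - u) ^ 2 + v ^ 2)) t)
    {a b : ℝ} (ha : IsAlgebraic ℚ a) (hb : IsAlgebraic ℚ b) :
    ∃ (S : Polynomial ℝ) (e₁ e₂ : ℝ), (∀ j, IsAlgebraic ℚ (S.coeff j)) ∧ IsAlgebraic ℚ e₁ ∧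
      IsAlgebraic ℚ e₂ ∧
      ∀ t : ℝ, HasDerivAt (fun x : ℝ => S.eval x / ((x - u) ^ 2 + v ^ 2) ^ (n + 1))
        ((a * t + b) / ((t - u) ^ 2 + v ^ 2) ^ (n + 1 + 1)
          - e₁ * (2 * (t - u)) / ((t - u) ^ 2 + v ^ 2) - e₂ * v / ((t - u) ^ 2 + v ^ 2)) t := by
  have h2 : IsAlgebraic ℚ (2:ℝ) := by simpa using isAlgebraic_nat (R := ℚ) (A := ℝ) 2
  have hn : IsAlgebraic ℚ ((n:ℝ) + 1) := (isAlgebraic_nat n).add isAlgebraic_one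
  have hc : IsAlgebraic ℚ (b + a * u) := hb.add (ha.mul hu)
  have hD : IsAlgebraic ℚ (2 * ((n:ℝ) + 1) * v ^ 2) := (h2.mul hn).mul (hva.pow 2)
  -- the three algebraic constants of the step
  set α : ℝ := -(a / 2) / ((n:ℝ) + 1) with hα
  set β : ℝ := (b + a * u) / (2 * ((n:ℝ) + 1) * v ^ 2) with hβ
  set κ : ℝ := (b + a * u) * (2 * n + 1) / (2 * ((n:ℝ) + 1) * v ^ 2) with hκ
  have hα_alg : IsAlgebraic ℚ α := quadPole_isAlgebraic_div (quadPole_isAlgebraic_div ha h2).neg hn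
  have hβ_alg : IsAlgebraic ℚ β := quadPole_isAlgebraic_div hc hD
  have hκ_alg : IsAlgebraic ℚ κ :=
    quadPole_isAlgebraic_div (hc.mul ((h2.mul (isAlgebraic_nat n)).add isAlgebraic_one)) hD
  obtain ⟨S₀, e₁, e₂, hS₀, he₁, he₂, hder⟩ := ih 0 κ isAlgebraic_zero hκ_alg
  refine ⟨C α + C β * (X - C u) + S₀ * ((X - C u) ^ 2 + C (v ^ 2)), e₁, e₂, ?_, he₁, he₂,
    fun t => ?_⟩
  · -- coefficients are algebraic
    have hXu : ∀ j, IsAlgebraic ℚ ((X - C u : ℝ[X]).coeff j) :=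
      quadPole_coeff_sub quadPole_coeff_X (quadPole_coeff_C hu)
    exact quadPole_coeff_add (quadPole_coeff_add (quadPole_coeff_C hα_alg)
      (quadPole_coeff_mul (quadPole_coeff_C hβ_alg) hXu))
      (quadPole_coeff_mul hS₀ (quadPole_coeff_add (quadPole_coeff_pow hXu 2)
        (quadPole_coeff_C (hva.pow 2))))
  · have hq : ∀ x : ℝ, (x - u) ^ 2 + v ^ 2 ≠ 0 := fun x => (quadPole_pos hv u x).ne'
    -- split `S/q^{n+1}` into the three pieces
    have hfun : (fun x : ℝ => (C α + C β * (X - C u) + S₀ * ((X - C u) ^ 2 + C (v ^ 2))).eval x /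
          ((x - u) ^ 2 + v ^ 2) ^ (n + 1))
        = fun x => α * (1 / ((x - u) ^ 2 + v ^ 2) ^ (n + 1))
            + β * ((x - u) / ((x - u) ^ 2 + v ^ 2) ^ (n + 1))
            + S₀.eval x / ((x - u) ^ 2 + v ^ 2) ^ n := by
      funext x
      have hqx := hq x
      simp only [eval_add, eval_mul, eval_C, eval_X, eval_pow, eval_sub]
      field_simp
      ring
    rw [hfun]
    refine ((((quadPole_hasDerivAt_inv_pow hv n t).const_mul α).add
      ((quadPole_hasDerivAt_lin_div_pow hv n t).const_mul β)).add (hder t)).congr_deriv ?_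
    have hqt := hq t
    have hn' : ((n:ℝ) + 1) ≠ 0 := by positivity
    simp only [hα, hβ, hκ]
    field_simp
    ring

/-- **Registered stub `stub_quadPoleReduction` (rung 8, W4 of the line `fibrewise_stokes`): the
reduction certificate for a power of a real quadratic.** For `v ≠ 0` and real algebraic
`u, v, a, b`: `(a t + b)/q^{n+1} = (S/qⁿ)′ + e₁ · (2(t − u))/q + e₂ · v/q`, `q = (t − u)² + v²`,
with `S ∈ ℝ[X]` of algebraic coefficients and `e₁, e₂` algebraic (induction on `n`:
`quadPole_base`, `quadPole_step`). [folklore] -/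
theorem stub_quadPoleReduction :
    ∀ (u v a b : ℝ) (n : ℕ), v ≠ 0 → IsAlgebraic ℚ u → IsAlgebraic ℚ v → IsAlgebraic ℚ a → IsAlgebraic ℚ b →
      ∃ (S : Polynomial ℝ) (e₁ e₂ : ℝ), (∀ j, IsAlgebraic ℚ (S.coeff j)) ∧ IsAlgebraic ℚ e₁ ∧ IsAlgebraic ℚ e₂ ∧
        ∀ t : ℝ, HasDerivAt (fun x : ℝ => S.eval x / ((x - u) ^ 2 + v ^ 2) ^ n)
          ((a * t + b) / ((t - u) ^ 2 + v ^ 2) ^ (n + 1)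
            - e₁ * (2 * (t - u)) / ((t - u) ^ 2 + v ^ 2) - e₂ * v / ((t - u) ^ 2 + v ^ 2)) t := by
  intro u v a b n hv hu hva ha hb
  induction n generalizing a b with
  | zero => exact quadPole_base hv hu hva ha hb
  | succ n ih => exact quadPole_step hv hu hva n (fun a b ha hb => ih a b ha hb) ha hb

end Summit.KontsevichZagierPeriods.KontsevichZagierPeriods.Cruxes.StokesGeneration.FibrewiseStokes
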